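import Literature.MathematicalPhysics.KineticTheory.HardSphereUniformDensityLLN
import Literature.MathematicalPhysics.KineticTheory.EvenStatTruncationBound
import Summits.AtomisticToContinuum.HydrodynamicLimit.Theorems.JParityClosureEvenStressEnskogVelocityFactorisation
import Summits.AtomisticToContinuum.HydrodynamicLimit.Theorems.JParityClosureEvenStressEnskogRung0LocalStatisticsHelpers
import HarnessLib

/-!
# Rung-0 local statistics (stub S3b1 `stub_rung0LocalStatistics` of the line
# `preshock-kinetic-slaving`, crux `JParityClosure.EvenStressEnskog`, stmt-AtomisticToContinuum-13079)
# — helper file 2: moments, density law of large numbers, velocity-test law of large numbers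

Statics of the rung-0 (constant-profile) local Gibbs law
`G_N = zipConfig_# (posGibbsMeasure a ε_N (N+1) ⊗ ⊗ᵢ N(u, θ id))` (`localGibbsMeasure_rung0_eq_map`)
at ONE window centre `x`:

* `lintegral_localGibbsLaw_constProfile`, `lintegral_posObs_localGibbsLaw_constProfile`,
  `lintegral_velObs_localGibbsLaw_constProfile`: `∫⁻` pull-back along `zipConfig` and the two marginals;
* `exists_lintegral_velMoments_le` (ii): `E[(N+1)⁻¹Σ‖vᵢ‖²]` and `E[((N+1)⁻¹Σ‖vᵢ‖²)²]` are bounded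
  uniformly in `N` (Gaussian second and fourth moments, `((N+1)⁻¹Σaᵢ)² ≤ (N+1)⁻¹Σaᵢ²`);
* `tendsto_lintegral_sq_mollDensity_sub_one` (iii): `E[(ρ_r(x) − 1)²] → 0`
  (`tendsto_integral_sq_empDensity_sub_one`, the mollified density depends on the positions only);
* `tendsto_lintegral_sq_velTest` (iv): for a continuous `G` with `|G v| ≤ C(1 + ‖v‖²)`,
  `E[(∫ b_r(y,x) G(v) dμ_w − ρ_r(x) ∫ G dN(u, θ id))²] ≤ (3/(πr³))² Var(G)/(N+1) → 0`
  (conditionally on the positions the velocities are i.i.d. `N(u, θ id)`: `integral_sq_sum_mul_pi`).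

References: H. Spohn, *Large Scale Dynamics of Interacting Particles* (1991), Part I §2.3.
-/

noncomputable section

open MeasureTheory ProbabilityTheory Filter Set Topology
open scoped ENNReal InnerProductSpace BigOperators

namespace Summit.AtomisticToContinuum.HydrodynamicLimit.Theorems.EvenStressEnskog

open Literature.Analysis.FluidPDE Literature.MathematicalPhysics.KineticTheory

/-! ## `∫⁻` transport along `zipConfig` -/

/-- Pull-back of `∫⁻` along `zipConfig` at rung 0 (no measurability needed: `zipConfig` is a
measurable embedding). [folklore] -/
theorem lintegral_localGibbsLaw_constProfile (σ : ℝ) {a θ : ℝ} (ha : 0 ≤ a) (hθ : 0 < θ) (u : V3)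
    (N : ℕ) (Φ : HardSphereFlow (Torus.geometry (Fin 3)) (hsDiameter σ N) (N + 1))
    (f : Config (N + 1) (Fin 3) T3 → ℝ≥0∞) :
    ∫⁻ z, f z ∂(localGibbsLaw σ (fun _ => a) (fun _ => u) (fun _ => θ) N Φ) =
      ∫⁻ p, f (zipConfig p) ∂((posGibbsMeasure (fun _ : T3 => a) (hsDiameter σ N) (N + 1)).prod
        (Measure.pi fun _ : Fin (N + 1) => gaussMeasure u θ)) := by
  rw [localGibbsLaw_eq, localGibbsMeasure_rung0_eq_map σ ha hθ u N,
    measurableEmbedding_zipConfig.lintegral_map]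

/-- **Position marginal in `∫⁻` form**: a measurable position observable integrates against the
configurational Gibbs measure. [folklore] -/
theorem lintegral_posObs_localGibbsLaw_constProfile (σ : ℝ) {a θ : ℝ} (ha : 0 ≤ a) (hθ : 0 < θ) (u : V3)
    (N : ℕ) (Φ : HardSphereFlow (Torus.geometry (Fin 3)) (hsDiameter σ N) (N + 1))
    {F : (Fin (N + 1) → T3) → ℝ≥0∞} (hF : Measurable F) :
    ∫⁻ z, F (fun i => (z i).1) ∂(localGibbsLaw σ (fun _ => a) (fun _ => u) (fun _ => θ) N Φ) =
      ∫⁻ x, F x ∂posGibbsMeasure (fun _ : T3 => a) (hsDiameter σ N) (N + 1) := by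
  rw [lintegral_localGibbsLaw_constProfile σ ha hθ u N Φ]
  have h : (fun p : (Fin (N + 1) → T3) × (Fin (N + 1) → V3) => F (fun i => (zipConfig p i).1)) =
      fun p => F p.1 := rfl
  rw [h, lintegral_prod (fun p : (Fin (N + 1) → T3) × (Fin (N + 1) → V3) => F p.1)
    (hF.comp measurable_fst).aemeasurable]
  refine lintegral_congr fun x => ?_
  show ∫⁻ _v, F x ∂(Measure.pi fun _ : Fin (N + 1) => gaussMeasure u θ) = F x
  rw [lintegral_const, measure_univ, mul_one]

/-- **Velocity marginal in `∫⁻` form**: a measurable velocity observable integrates against the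
product Gaussian (`a > 0`, `σ ≤ 1/2`, so that the configurational Gibbs measure is a probability
measure). [folklore] -/
theorem lintegral_velObs_localGibbsLaw_constProfile (σ : ℝ) {a θ : ℝ} (ha : 0 < a) (hθ : 0 < θ)
    (hσ2 : σ ≤ 1 / 2) (u : V3) (N : ℕ)
    (Φ : HardSphereFlow (Torus.geometry (Fin 3)) (hsDiameter σ N) (N + 1))
    {H : (Fin (N + 1) → V3) → ℝ≥0∞} (hH : Measurable H) :
    ∫⁻ z, H (fun i => (z i).2) ∂(localGibbsLaw σ (fun _ => a) (fun _ => u) (fun _ => θ) N Φ) =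
      ∫⁻ v, H v ∂(Measure.pi fun _ : Fin (N + 1) => gaussMeasure u θ) := by
  haveI := isProbabilityMeasure_posGibbsMeasure (a₀ := fun _ : T3 => a) continuous_const
    (fun _ => ha) hσ2 N
  rw [lintegral_localGibbsLaw_constProfile σ ha.le hθ u N Φ]
  have h : (fun p : (Fin (N + 1) → T3) × (Fin (N + 1) → V3) => H (fun i => (zipConfig p i).2)) =
      fun p => H p.2 := rfl
  rw [h, lintegral_prod (fun p : (Fin (N + 1) → T3) × (Fin (N + 1) → V3) => H p.2)
    (hH.comp measurable_snd).aemeasurable]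
  show ∫⁻ _x, ∫⁻ v, H v ∂(Measure.pi fun _ : Fin (N + 1) => gaussMeasure u θ)
    ∂posGibbsMeasure (fun _ : T3 => a) (hsDiameter σ N) (N + 1) = _
  rw [lintegral_const, measure_univ, mul_one]

/-! ## (ii) Velocity moment bounds -/

/-- `((N+1)⁻¹ Σᵢ aᵢ)² ≤ (N+1)⁻¹ Σᵢ aᵢ²` (Cauchy–Schwarz). [folklore] -/
theorem sq_succAvg_le_succAvg_sq {N : ℕ} (f : Fin (N + 1) → ℝ) :
    (((N + 1 : ℕ) : ℝ)⁻¹ * ∑ i, f i) ^ 2 ≤ ((N + 1 : ℕ) : ℝ)⁻¹ * ∑ i, f i ^ 2 := by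
  have hn : (0 : ℝ) < ((N + 1 : ℕ) : ℝ) := by positivity
  have h := sq_sum_le_card_mul_sum_sq (s := (Finset.univ : Finset (Fin (N + 1)))) (f := f)
  rw [Finset.card_univ, Fintype.card_fin] at h
  calc (((N + 1 : ℕ) : ℝ)⁻¹ * ∑ i, f i) ^ 2
      = ((N + 1 : ℕ) : ℝ)⁻¹ * ((N + 1 : ℕ) : ℝ)⁻¹ * (∑ i, f i) ^ 2 := by ring
    _ ≤ ((N + 1 : ℕ) : ℝ)⁻¹ * ((N + 1 : ℕ) : ℝ)⁻¹ * (((N + 1 : ℕ) : ℝ) * ∑ i, f i ^ 2) :=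
        mul_le_mul_of_nonneg_left h (by positivity)
    _ = ((N + 1 : ℕ) : ℝ)⁻¹ * ∑ i, f i ^ 2 := by
        field_simp

/-- **Moments of the product Gaussian**: `(N+1)⁻¹ Σᵢ ‖vᵢ‖ᵖ` is integrable under `⊗ᵢ N(u, θ id)` with
integral `∫ ‖v‖ᵖ dN(u, θ id)` (`p ≥ 1`). [folklore] -/
theorem integral_succAvg_norm_pow_pi (u : V3) (θ : ℝ) (N : ℕ) {p : ℕ} (hp : p ≠ 0) :
    Integrable (fun v : Fin (N + 1) → V3 => ((N + 1 : ℕ) : ℝ)⁻¹ * ∑ i, ‖v i‖ ^ p)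
        (Measure.pi fun _ : Fin (N + 1) => gaussMeasure u θ) ∧
      ∫ v, ((N + 1 : ℕ) : ℝ)⁻¹ * ∑ i, ‖v i‖ ^ p ∂(Measure.pi fun _ : Fin (N + 1) => gaussMeasure u θ) =
        ∫ y, ‖y‖ ^ p ∂gaussMeasure u θ := by
  have hg : Integrable (fun y : V3 => ‖y‖ ^ p) (gaussMeasure u θ) :=
    (IsGaussian.memLp_id _ p (by simp)).integrable_norm_pow hp
  have hgi : ∀ i : Fin (N + 1), Integrable (fun v : Fin (N + 1) → V3 => ‖v i‖ ^ p)
      (Measure.pi fun _ : Fin (N + 1) => gaussMeasure u θ) := fun i =>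
    ((measurePreserving_eval (fun _ : Fin (N + 1) => gaussMeasure u θ) i).integrable_comp
      hg.aestronglyMeasurable).2 hg
  have hev : ∀ i : Fin (N + 1), ∫ v, ‖v i‖ ^ p ∂(Measure.pi fun _ : Fin (N + 1) => gaussMeasure u θ) =
      ∫ y, ‖y‖ ^ p ∂gaussMeasure u θ := by
    intro i
    have h := integral_map (μ := Measure.pi fun _ : Fin (N + 1) => gaussMeasure u θ)
      (measurable_pi_apply i).aemeasurable (f := fun y : V3 => ‖y‖ ^ p)
      (by rw [(measurePreserving_eval (fun _ : Fin (N + 1) => gaussMeasure u θ) i).map_eq]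
          exact hg.aestronglyMeasurable)
    rw [(measurePreserving_eval (fun _ : Fin (N + 1) => gaussMeasure u θ) i).map_eq] at h
    exact h.symm
  refine ⟨(integrable_finsetSum _ fun i _ => hgi i).const_mul _, ?_⟩
  rw [integral_const_mul, integral_finsetSum _ fun i _ => hgi i]
  simp_rw [hev]
  rw [Finset.sum_const, Finset.card_univ, Fintype.card_fin, nsmul_eq_mul, ← mul_assoc,
    inv_mul_cancel₀ (by positivity), one_mul]

/-- **(ii) Velocity moment bounds at rung 0**: with `K = ∫ ‖v‖² dN(u,θ id) + ∫ ‖v‖⁴ dN(u,θ id)`,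
`E[(N+1)⁻¹Σ‖vᵢ‖²] ≤ K` and `E[((N+1)⁻¹Σ‖vᵢ‖²)²] ≤ K` for every `N` and every flow. [folklore] -/
theorem exists_lintegral_velMoments_le (σ : ℝ) {a θ : ℝ} (ha : 0 < a) (hθ : 0 < θ)
    (hσ2 : σ ≤ 1 / 2) (u : V3)
    (Φ : (N : ℕ) → HardSphereFlow (Torus.geometry (Fin 3)) (hsDiameter σ N) (N + 1)) :
    ∃ K : ℝ, ∀ N : ℕ,
      ∫⁻ w, ENNReal.ofReal (((N + 1 : ℕ) : ℝ)⁻¹ * ∑ i, ‖(w i).2‖ ^ 2)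
          ∂(localGibbsLaw σ (fun _ => a) (fun _ => u) (fun _ => θ) N (Φ N)) ≤ ENNReal.ofReal K ∧
      ∫⁻ w, ENNReal.ofReal ((((N + 1 : ℕ) : ℝ)⁻¹ * ∑ i, ‖(w i).2‖ ^ 2) ^ 2)
          ∂(localGibbsLaw σ (fun _ => a) (fun _ => u) (fun _ => θ) N (Φ N)) ≤ ENNReal.ofReal K := by
  have hm₂0 : 0 ≤ ∫ y, ‖y‖ ^ 2 ∂gaussMeasure u θ := integral_nonneg fun _ => by positivity
  have hm₄0 : 0 ≤ ∫ y, ‖y‖ ^ 4 ∂gaussMeasure u θ := integral_nonneg fun _ => by positivity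
  refine ⟨(∫ y, ‖y‖ ^ 2 ∂gaussMeasure u θ) + ∫ y, ‖y‖ ^ 4 ∂gaussMeasure u θ, fun N => ?_⟩
  have hmeas : ∀ p : ℕ, Measurable fun v : Fin (N + 1) → V3 =>
      ((N + 1 : ℕ) : ℝ)⁻¹ * ∑ i, ‖v i‖ ^ p := fun p =>
    measurable_const.mul (Finset.measurable_sum _ fun i _ => (measurable_pi_apply i).norm.pow_const p)
  obtain ⟨hint2, hval2⟩ := integral_succAvg_norm_pow_pi u θ N two_ne_zero
  obtain ⟨hint4, hval4⟩ := integral_succAvg_norm_pow_pi u θ N (by norm_num : (4 : ℕ) ≠ 0)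
  constructor
  · rw [lintegral_velObs_localGibbsLaw_constProfile σ ha hθ hσ2 u N (Φ N) (hmeas 2).ennreal_ofReal,
      ← ofReal_integral_eq_lintegral_ofReal hint2 (ae_of_all _ fun v => by positivity), hval2]
    exact ENNReal.ofReal_le_ofReal (le_add_of_nonneg_right hm₄0)
  · rw [lintegral_velObs_localGibbsLaw_constProfile σ ha hθ hσ2 u N (Φ N)
      ((hmeas 2).pow_const 2).ennreal_ofReal]
    calc ∫⁻ v, ENNReal.ofReal ((((N + 1 : ℕ) : ℝ)⁻¹ * ∑ i, ‖v i‖ ^ 2) ^ 2)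
          ∂(Measure.pi fun _ : Fin (N + 1) => gaussMeasure u θ)
        ≤ ∫⁻ v, ENNReal.ofReal (((N + 1 : ℕ) : ℝ)⁻¹ * ∑ i, ‖v i‖ ^ 4)
          ∂(Measure.pi fun _ : Fin (N + 1) => gaussMeasure u θ) := by
          refine lintegral_mono fun v => ENNReal.ofReal_le_ofReal ?_
          have h := sq_succAvg_le_succAvg_sq fun i => ‖v i‖ ^ 2
          simp_rw [← pow_mul] at h
          exact h
      _ = ENNReal.ofReal (∫ y, ‖y‖ ^ 4 ∂gaussMeasure u θ) := by
          rw [← ofReal_integral_eq_lintegral_ofReal hint4 (ae_of_all _ fun v => by positivity), hval4]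
      _ ≤ ENNReal.ofReal ((∫ y, ‖y‖ ^ 2 ∂gaussMeasure u θ) + ∫ y, ‖y‖ ^ 4 ∂gaussMeasure u θ) :=
          ENNReal.ofReal_le_ofReal (le_add_of_nonneg_left hm₂0)

/-! ## (iii) The mollified density at a point -/

/-- **(iii) `L²` law of large numbers of the mollified density at rung 0**: at small reduced
density, for `0 < r < 1/2` and every window centre `x`, `E[(ρ_r(x) − 1)²] → 0`
(`tendsto_integral_sq_empDensity_sub_one` transported to the local Gibbs law). [folklore] -/
theorem tendsto_lintegral_sq_mollDensity_sub_one {σ a θ : ℝ} (hsd : SmallDensity uniformProfile σ)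
    (ha : 0 < a) (hθ : 0 < θ) (u : V3)
    (Φ : (N : ℕ) → HardSphereFlow (Torus.geometry (Fin 3)) (hsDiameter σ N) (N + 1))
    {r : ℝ} (hr : 0 < r) (hr2 : r < 1 / 2) (x : T3) :
    Tendsto (fun N : ℕ => ∫⁻ w, ENNReal.ofReal ((mollDensity r w x - 1) ^ 2)
      ∂(localGibbsLaw σ (fun _ => a) (fun _ => u) (fun _ => θ) N (Φ N))) atTop (𝓝 0) := by
  have hρ : ∀ (N : ℕ) (w : Config (N + 1) (Fin 3) T3),
      mollDensity r w x = empDensity r (fun i => (w i).1) x := fun N w => by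
    rw [mollDensity_eq_avg, empDensity]
  have heq : ∀ N : ℕ, ∫⁻ w, ENNReal.ofReal ((mollDensity r w x - 1) ^ 2)
      ∂(localGibbsLaw σ (fun _ => a) (fun _ => u) (fun _ => θ) N (Φ N)) =
      ENNReal.ofReal (∫ xs, (empDensity r xs x - 1) ^ 2
        ∂posGibbsMeasure (fun _ : T3 => a) (hsDiameter σ N) (N + 1)) := by
    intro N
    haveI := isProbabilityMeasure_posGibbsMeasure (a₀ := fun _ : T3 => a) continuous_const
      (fun _ => ha) hsd.σ_lt_half.le N
    have hFm : Measurable fun xs : Fin (N + 1) → T3 => (empDensity r xs x - 1) ^ 2 := by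
      have h : Measurable fun xs : Fin (N + 1) → T3 => empDensity r xs x := by
        unfold empDensity
        exact measurable_const.mul (Finset.measurable_sum _ fun k _ =>
          measurable_coneKernel_comp r (measurable_pi_apply k) measurable_const)
      exact (h.sub_const 1).pow_const 2
    have hFi : Integrable (fun xs : Fin (N + 1) → T3 => (empDensity r xs x - 1) ^ 2)
        (posGibbsMeasure (fun _ : T3 => a) (hsDiameter σ N) (N + 1)) := by
      refine Integrable.of_bound hFm.aestronglyMeasurable ((3 / (Real.pi * r ^ 3) + 1) ^ 2)
        (ae_of_all _ fun xs => ?_)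
      obtain ⟨h0, h1⟩ := empDensity_mem_Icc hr xs x
      rw [Real.norm_eq_abs, abs_of_nonneg (sq_nonneg _), ← sq_abs]
      refine pow_le_pow_left₀ (abs_nonneg _) ?_ 2
      rw [abs_le]; constructor <;> linarith
    simp_rw [hρ]
    rw [lintegral_posObs_localGibbsLaw_constProfile σ ha.le hθ u N (Φ N) hFm.ennreal_ofReal,
      ofReal_integral_eq_lintegral_ofReal hFi (ae_of_all _ fun _ => sq_nonneg _)]
  simp_rw [heq]
  have h := ENNReal.tendsto_ofReal (tendsto_integral_sq_empDensity_sub_one hsd ha hr hr2 x)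
  rwa [ENNReal.ofReal_zero] at h

/-! ## (iv) Quadratic-growth velocity tests -/

/-- **(iv) `L²` law of large numbers of the velocity tests at rung 0.**  For constant profiles
`a, θ > 0`, `u`, `σ ≤ 1/2`, every flow family, `r > 0`, `x`, and a continuous `G` with
`|G v| ≤ C(1 + ‖v‖²)`:
`E[(∫ b_r(y,x) G(v) dμ_w(y,v) − ρ_r(x) ∫ G dN(u, θ id))²] → 0` as `N → ∞`; indeed it is
`≤ (3/(πr³))² Var(G)/(N+1)`: conditionally on the positions the summands
`b_r(xᵢ,x)(G(vᵢ) − EG)` are independent and centred. [folklore] -/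
theorem tendsto_lintegral_sq_velTest :
    ∀ (σ : ℝ) {a θ : ℝ}, 0 < a → 0 < θ → σ ≤ 1 / 2 → ∀ (u : V3)
    (Φ : (N : ℕ) → HardSphereFlow (Torus.geometry (Fin 3)) (hsDiameter σ N) (N + 1))
    {r : ℝ}, 0 < r → ∀ (x : T3) {G : V3 → ℝ}, Continuous G →
    (∃ C : ℝ, ∀ v, |G v| ≤ C * (1 + ‖v‖ ^ 2)) →
    Tendsto (fun N : ℕ => ∫⁻ w, ENNReal.ofReal
        (((∫ q, coneKernel r q.1 x * G q.2 ∂(empiricalMeasure w)) -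
          mollDensity r w x * ∫ v, G v ∂(gaussMeasure u θ)) ^ 2)
      ∂(localGibbsLaw σ (fun _ => a) (fun _ => u) (fun _ => θ) N (Φ N))) atTop (𝓝 0) := by
  intro σ a θ ha hθ hσ2 u Φ r hr x G hG hC
  obtain ⟨C, hC⟩ := hC
  set γ : Measure V3 := gaussMeasure u θ with hγ
  set Gbar : ℝ := ∫ v, G v ∂γ with hGbar
  set M : ℝ := 3 / (Real.pi * r ^ 3) with hM
  set VY : ℝ := ∫ v, (G v - Gbar) ^ 2 ∂γ with hVY
  have hM0 : 0 ≤ M := by positivity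
  have hVY0 : 0 ≤ VY := integral_nonneg fun _ => sq_nonneg _
  have hG2 : MemLp G 2 γ := memLp_two_gaussMeasure_of_abs_le hG hC u θ
  have hY : MemLp (fun v => G v - Gbar) 2 γ := hG2.sub (memLp_const _)
  have hY0 : ∫ v, (G v - Gbar) ∂γ = 0 := by
    rw [integral_sub (hG2.integrable one_le_two) (integrable_const _), integral_const,
      probReal_univ, one_smul, sub_self]
  have hbound : ∀ N : ℕ, ∫⁻ w, ENNReal.ofReal
      (((∫ q, coneKernel r q.1 x * G q.2 ∂(empiricalMeasure w)) - mollDensity r w x * Gbar) ^ 2)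
      ∂(localGibbsLaw σ (fun _ => a) (fun _ => u) (fun _ => θ) N (Φ N)) ≤
      ENNReal.ofReal (M ^ 2 * VY / (((N + 1 : ℕ) : ℝ) * 1)) := by
    intro N
    haveI := isProbabilityMeasure_posGibbsMeasure (a₀ := fun _ : T3 => a) continuous_const
      (fun _ => ha) hσ2 N
    set n : ℝ := ((N + 1 : ℕ) : ℝ) with hn
    have hn0 : 0 < n := by positivity
    set Ppos := posGibbsMeasure (fun _ : T3 => a) (hsDiameter σ N) (N + 1) with hPpos
    set Pvel : Measure (Fin (N + 1) → V3) := Measure.pi fun _ : Fin (N + 1) => γ with hPvel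
    -- the integrand after `zipConfig`
    have hX : ∀ (xs : Fin (N + 1) → T3) (vs : Fin (N + 1) → V3),
        (∫ q, coneKernel r q.1 x * G q.2 ∂(empiricalMeasure (zipConfig (xs, vs)))) -
          mollDensity r (zipConfig (xs, vs)) x * Gbar =
        n⁻¹ * ∑ i, coneKernel r (xs i) x * (G (vs i) - Gbar) := by
      intro xs vs
      rw [integral_empiricalMeasure, mollDensity_eq_avg]
      simp only [zipConfig_apply, mul_sub, Finset.sum_sub_distrib]
      rw [← Finset.sum_mul]
      ring
    have hFm : Measurable fun p : (Fin (N + 1) → T3) × (Fin (N + 1) → V3) =>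
        ENNReal.ofReal ((n⁻¹ * ∑ i, coneKernel r (p.1 i) x * (G (p.2 i) - Gbar)) ^ 2) := by
      refine ((measurable_const.mul (Finset.measurable_sum _ fun i _ => ?_)).pow_const 2).ennreal_ofReal
      exact (measurable_coneKernel_comp r ((measurable_pi_apply i).comp measurable_fst)
        measurable_const).mul ((hG.measurable.comp ((measurable_pi_apply i).comp measurable_snd)).sub_const _)
    -- the conditional (velocity) second moment, uniformly in the positions
    have hinner : ∀ xs : Fin (N + 1) → T3,
        ∫⁻ vs, ENNReal.ofReal ((n⁻¹ * ∑ i, coneKernel r (xs i) x * (G (vs i) - Gbar)) ^ 2) ∂Pvel ≤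
          ENNReal.ofReal (M ^ 2 * VY / (n * 1)) := by
      intro xs
      set b : Fin (N + 1) → ℝ := fun i => coneKernel r (xs i) x with hb
      have hS : MemLp (fun vs : Fin (N + 1) → V3 => ∑ i, b i * (G (vs i) - Gbar)) 2 Pvel :=
        memLp_sum_mul_pi γ hY b
      have hint : Integrable (fun vs : Fin (N + 1) → V3 =>
          (n⁻¹ * ∑ i, b i * (G (vs i) - Gbar)) ^ 2) Pvel := (hS.const_mul n⁻¹).integrable_sq
      have hsumb : ∑ i, b i ^ 2 ≤ n * M ^ 2 := by
        calc ∑ i, b i ^ 2 ≤ ∑ _i : Fin (N + 1), M ^ 2 := Finset.sum_le_sum fun i _ =>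
              pow_le_pow_left₀ (coneKernel_mem_Icc hr _ _).1 (coneKernel_mem_Icc hr _ _).2 2
          _ = n * M ^ 2 := by
              rw [Finset.sum_const, Finset.card_univ, Fintype.card_fin, nsmul_eq_mul]
      show ∫⁻ vs, ENNReal.ofReal ((n⁻¹ * ∑ i, b i * (G (vs i) - Gbar)) ^ 2) ∂Pvel ≤ _
      rw [← ofReal_integral_eq_lintegral_ofReal hint (ae_of_all _ fun _ => sq_nonneg _)]
      refine ENNReal.ofReal_le_ofReal ?_
      calc ∫ vs, (n⁻¹ * ∑ i, b i * (G (vs i) - Gbar)) ^ 2 ∂Pvel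
          = n⁻¹ ^ 2 * ((∑ i, b i ^ 2) * VY) := by
            simp_rw [mul_pow]
            rw [integral_const_mul, integral_sq_sum_mul_pi γ hY hY0 b]
        _ ≤ n⁻¹ ^ 2 * ((n * M ^ 2) * VY) := by gcongr
        _ = M ^ 2 * VY / (n * 1) := by
            field_simp
    -- assemble (Tonelli, positions outside)
    calc ∫⁻ w, ENNReal.ofReal (((∫ q, coneKernel r q.1 x * G q.2 ∂(empiricalMeasure w)) -
            mollDensity r w x * Gbar) ^ 2) ∂(localGibbsLaw σ (fun _ => a) (fun _ => u) (fun _ => θ) N (Φ N))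
        = ∫⁻ p, ENNReal.ofReal ((n⁻¹ * ∑ i, coneKernel r (p.1 i) x * (G (p.2 i) - Gbar)) ^ 2)
            ∂(Ppos.prod Pvel) := by
          rw [lintegral_localGibbsLaw_constProfile σ ha.le hθ u N (Φ N)]
          refine lintegral_congr fun p => ?_
          obtain ⟨xs, vs⟩ := p
          rw [hX]
      _ = ∫⁻ xs, ∫⁻ vs, ENNReal.ofReal ((n⁻¹ * ∑ i, coneKernel r (xs i) x * (G (vs i) - Gbar)) ^ 2)
            ∂Pvel ∂Ppos := lintegral_prod _ hFm.aemeasurable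
      _ ≤ ∫⁻ _xs, ENNReal.ofReal (M ^ 2 * VY / (n * 1)) ∂Ppos := lintegral_mono fun xs => hinner xs
      _ = ENNReal.ofReal (M ^ 2 * VY / (n * 1)) := by rw [lintegral_const, measure_univ, mul_one]
  exact tendsto_of_tendsto_of_tendsto_of_le_of_le tendsto_const_nhds
    (tendsto_ofReal_div_succ_mul (M ^ 2 * VY) 1) (fun N => zero_le) hbound

end Summit.AtomisticToContinuum.HydrodynamicLimit.Theorems.EvenStressEnskog

end
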